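import Literature.NumberTheory.ComplexMultiplication.PairFlipTransportPairwise
import Literature.NumberTheory.ComplexMultiplication.ReflexSlotRankCollapse
import HarnessLib

/-!
# The dichotomy for an irreducible slot, and the TYPED transport through a pair-flip slot: a degenerate pair is a
# relabelling carrying one type onto the other

COR-CM (cell `pub-hodgecm2`, binder seat `b16` gen 51, count-neutral claim PAIRFLIP-COMPANION, file F5 — abstract
`G`-set level; theorems only, no definition, no named fact, no `sorry`).  NEW as stated, hence under `Summits/`.  HONEST
FRAMING: finite-dimensional linear algebra about families of CM types; `HC_CM` is neither used nor asserted.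

SETTING (two-slot family `I = {i₀, i₁}`, tree notation): `U(Φ_i) = antiSpan G (Φ_i)`, `U(Σ) = antiSpan G (sigmaType Φ)`,
slot extensions `ext_i`, slot restrictions `r_i`; ADDITIVE means `ext_i U(Φ_i) ≤ U(Σ)` for both `i`
(`rank(Σ) − 1 = Σ_i (rank Φ_i − 1)`, `Hg(A₀ × A₁) = Hg(A₀) × Hg(A₁)`; `typeRank_sigmaType_add_card_eq_of_forall_map_le`).

* §1 **`additive_or_exists_collapse_of_irreducible`** — if `U(Φ_{i₀})` is IRREDUCIBLE (no stable subspace other than `0`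
  and itself) then EITHER the pair is additive, OR there is a `G`-equivariant linear `L : ℚ^{E_{i₁}} → ℚ^{E_{i₀}}` with
  `L(U(Φ_{i₁})) ≤ U(Φ_{i₀})` and `L(u_1(Φ_{i₁})) = u_1(Φ_{i₀})` — the hypothesis of the tree's rank COLLAPSE
  `ReflexSlot.typeRank_sigmaType_eq_of_equivariant` (`rank(Σ) = rank(Φ_{i₁})`: `Hg(A₀ × A₁) → Hg(A₁)` is an isogeny).
  Goursat for the subdirect `U(Σ) ≤ U(Φ_{i₀}) ⊕ U(Φ_{i₁})`: the stable `W = {w ∈ U(Φ_{i₀}) | ext_{i₀} w ∈ U(Σ)}` is `U(Φ_{i₀})`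
  (additive) or `0` (then `r_{i₁}` is injective on `U(Σ)` and `L = r_{i₀} ∘ (r_{i₁}|_{U(Σ)})⁻¹ ∘ π_{U(Φ_{i₁})}`).  Rank form
  `typeRank_add_card_eq_or_typeRank_eq_of_irreducible`.  This is the CONVERSE of the collapse for irreducible slots; the
  tree's stabiliser separation (`CMTypeRankTypeConjugation` §2) is the special case "`L` cannot exist".
* §2 **`exists_equivariant_equiv_mem_iff_of_not_additive`** — `X = E_{i₀}` transitive with PAIR FLIPS COMPATIBLE WITH
  `Y = E_{i₁}` (F1), `|X| = |Y|`: if the pair is NOT additive there is a `G`-equivariant bijection `γ : X ≃ Y` CARRYING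
  `Φ_{i₀}` ONTO `Φ_{i₁}` (`x ∈ Φ_{i₀} ↔ γx ∈ Φ_{i₁}`).  (§1 gives `L` with `L u_{i₁} = u_{i₀}`; `L` is injective on
  `U(Φ_{i₁})` by a dimension count, its inverse `S` (F1b) is an equivariant injection `Anti(X) → Anti(Y)` with
  `S u_{i₀} = u_{i₁}`; F1 makes `S = c·(γ⁻¹)^*` with ONE constant `c > 0` (transitivity, `apply_eq_smul_comp_symm`), and
  `u_{i₁}(γx) = c·u_{i₀}(x)` with values `±1` forces `c = 1`.)  For CM fields (sequel `PairFlipCompanionIsogeny`):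
  `Hg(A₀ × A₁) ≠ Hg(A₀) × Hg(A₁)` forces `K₀ ≅ K₁` WITH `Φ₁ = Φ₀ ∘ e⁻¹`, i.e. `A₀ ~ A₁` ISOGENOUS.

## References

* [Gordon1999HodgeAVSurvey] B. B. Gordon, *A survey of the Hodge conjecture for abelian varieties*, §3 Theorem (Imai,
  Murty) with proof, 7.5–7.7.
* [Serre1977] J.-P. Serre, *Linear Representations of Finite Groups*, GTM 42, §1.3 Thm. 1, §2.2 (Schur).
* [Dodson1984] B. Dodson, *The structure of Galois groups of CM-fields*, Trans. AMS 283 (1984), §1.1, §5.1.2.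
* [Shimura1998] G. Shimura, *Abelian Varieties with Complex Multiplication and Modular Functions*, §32.10.

Provenance: Literature home (namespace `Literature.NumberTheory.ComplexMultiplication`) of the Summits-side `CorCM/PairFlipTransportDichotomy` (cell `pub-hodgecm2`, COR-CM; all its imports are `Literature/`, Mathlib and the already re-homed `PairFlipTransportPairwise`, `ReflexSlotRankCollapse`), which `Literature/` may not import; theorems only, no named fact, no definition. Nothing here bears on `HC_CM`. Lane `lit-hodgefound` (Layer A3: CM types, their Kubota ranks and Galois combinatorics), seat p20.
-/

set_option autoImplicit false

open scoped BigOperators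

namespace Literature.NumberTheory.ComplexMultiplication

open Literature.NumberTheory.ComplexMultiplication.PointwiseConjugation Literature.NumberTheory.ComplexMultiplication.ReflexSlotRank

namespace PairFlipTransport

open Literature.NumberTheory.ComplexMultiplication

variable {G : Type*} [Group G] {I : Type*} {E : I → Type*} [∀ i, MulAction G (E i)] [DecidableEq I] [Fintype I]
  {ρ : G} {Φ : ∀ i, Set (E i)} {i₀ i₁ : I}

/-! ### §1 Goursat: an irreducible slot is additive or collapses -/

omit [Fintype I] in
/-- In a two-slot family a weight is the sum of the extensions of its two slot restrictions. [cite: Serre1977, §2.2] -/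
theorem eq_slotExt_add_slotExt (hI : ∀ j, j = i₀ ∨ j = i₁) (h01 : i₀ ≠ i₁) (v : (Σ k, E k) → ℚ) :
    v = slotExt i₀ (LinearMap.funLeft ℚ ℚ (Sigma.mk i₀) v) + slotExt i₁ (LinearMap.funLeft ℚ ℚ (Sigma.mk i₁) v) := by
  funext x
  obtain ⟨j, s⟩ := x
  rw [Pi.add_apply]
  rcases hI j with rfl | rfl
  · rw [slotExt_apply_same, slotExt_apply_of_ne h01, add_zero, LinearMap.funLeft_apply]
  · rw [slotExt_apply_same, slotExt_apply_of_ne (Ne.symm h01), zero_add, LinearMap.funLeft_apply]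

/-- **The dichotomy for an irreducible slot.**  `I = {i₀, i₁}`, `U(Φ_{i₀})` irreducible: either both slot extensions lie
in `U(Σ)` (the pair is additive), or a `G`-equivariant `L : ℚ^{E_{i₁}} → ℚ^{E_{i₀}}` maps `U(Φ_{i₁})` into `U(Φ_{i₀})` with
`L(u_1(Φ_{i₁})) = u_1(Φ_{i₀})` (the pair collapses onto the slot `i₁`).
[cite: Gordon1999HodgeAVSurvey, §3 Theorem (proof) and 7.5–7.7] [cite: Serre1977, §2.2] -/
theorem additive_or_exists_collapse_of_irreducible [Fintype (E i₁)] (hI : ∀ j, j = i₀ ∨ j = i₁) (h01 : i₀ ≠ i₁)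
    (hirr : ∀ W : Submodule ℚ (E i₀ → ℚ), W ≤ antiSpan G (Φ i₀) → W ≠ ⊥ →
      (∀ (k : G) (f : E i₀ → ℚ), f ∈ W → (fun y => f (k • y)) ∈ W) → W = antiSpan G (Φ i₀)) :
    (∀ i, (antiSpan G (Φ i)).map (slotExt i) ≤ antiSpan G (sigmaType Φ)) ∨
      ∃ L : (E i₁ → ℚ) →ₗ[ℚ] (E i₀ → ℚ), (∀ (g : G) (f : E i₁ → ℚ), L (fun y => f (g • y)) = fun x => L f (g • x)) ∧
        (∀ f, f ∈ antiSpan G (Φ i₁) → L f ∈ antiSpan G (Φ i₀)) ∧ L (antiVec (Φ i₁) (1 : G)) = antiVec (Φ i₀) (1 : G) := by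
  classical
  set M := antiSpan G (sigmaType Φ) with hM
  set r₀ : ((Σ k, E k) → ℚ) →ₗ[ℚ] (E i₀ → ℚ) := LinearMap.funLeft ℚ ℚ (Sigma.mk i₀) with hr₀
  set r₁ : ((Σ k, E k) → ℚ) →ₗ[ℚ] (E i₁ → ℚ) := LinearMap.funLeft ℚ ℚ (Sigma.mk i₁) with hr₁
  have hMst : ∀ (k : G) (f : (Σ j, E j) → ℚ), f ∈ M → (fun x => f (k • x)) ∈ M :=
    fun k f hf => comp_smul_mem_antiSpan hf k
  have hr₀M : ∀ v, v ∈ M → r₀ v ∈ antiSpan G (Φ i₀) := fun v hv => by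
    rw [← map_funLeft_mk_antiSpan_sigmaType Φ i₀]; exact Submodule.mem_map_of_mem hv
  have hr₁M : ∀ v, v ∈ M → r₁ v ∈ antiSpan G (Φ i₁) := fun v hv => by
    rw [← map_funLeft_mk_antiSpan_sigmaType Φ i₁]; exact Submodule.mem_map_of_mem hv
  -- the Goursat kernel `W = {w ∈ U(Φ_{i₀}) | ext_{i₀} w ∈ U(Σ)}`
  set W : Submodule ℚ (E i₀ → ℚ) := antiSpan G (Φ i₀) ⊓ M.comap (slotExt i₀) with hW
  have hWst : ∀ (k : G) (f : E i₀ → ℚ), f ∈ W → (fun y => f (k • y)) ∈ W := by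
    intro k f hf
    refine ⟨comp_smul_mem_antiSpan hf.1 k, ?_⟩
    change slotExt i₀ (fun y => f (k • y)) ∈ M
    rw [← slotExt_comp_smul]
    exact hMst k _ hf.2
  by_cases hW0 : W = ⊥
  · -- `W = 0`: `r₁` is injective on `U(Σ)`; invert it and compose with `r₀`
    right
    have hinj : ∀ v, v ∈ M → r₁ v = 0 → v = 0 := by
      intro v hv hv0
      have hv' : v = slotExt i₀ (r₀ v) := by
        have h := eq_slotExt_add_slotExt hI h01 v
        change v = slotExt i₀ (r₀ v) + slotExt i₁ (r₁ v) at h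
        rw [hv0, map_zero, add_zero] at h
        exact h
      have hmem : r₀ v ∈ W := ⟨hr₀M v hv, by change slotExt i₀ (r₀ v) ∈ M; rw [← hv']; exact hv⟩
      rw [hW0, Submodule.mem_bot] at hmem
      rw [hv', hmem, map_zero]
    obtain ⟨S, hSM, hSr, -, hSeq, -⟩ :=
      exists_inverse_on_map (G := G) M (fun k f hf => hMst k f hf) r₁ (fun k f _ => rfl) hinj
    have hmap : M.map r₁ = antiSpan G (Φ i₁) := by rw [hr₁, hM, map_funLeft_mk_antiSpan_sigmaType]
    rw [hmap] at hSeq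
    -- an equivariant projection onto `U(Φ_{i₁})` makes the composite globally equivariant
    obtain ⟨π, hπmem, hπid, hπeq⟩ := PointwiseConj.exists_equivariant_proj (G := G) (antiSpan G (Φ i₁))
      (fun k f hf => comp_smul_mem_antiSpan hf k)
    refine ⟨r₀ ∘ₗ S ∘ₗ π, fun g f => ?_, fun f _ => hr₀M _ (hSM _), ?_⟩
    · change r₀ (S (π fun y => f (g • y))) = fun x => r₀ (S (π f)) (g • x)
      rw [hπeq g f, hSeq g (π f) (hπmem f)]
      rfl
    · have hu : antiVec (sigmaType Φ) (1 : G) ∈ M := Submodule.subset_span ⟨1, rfl⟩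
      have hu₁ : antiVec (Φ i₁) (1 : G) ∈ antiSpan G (Φ i₁) := Submodule.subset_span ⟨1, rfl⟩
      have h1 : r₁ (antiVec (sigmaType Φ) (1 : G)) = antiVec (Φ i₁) (1 : G) := funLeft_mk_antiVec_sigmaType Φ i₁ 1
      change r₀ (S (π (antiVec (Φ i₁) (1 : G)))) = antiVec (Φ i₀) (1 : G)
      rw [hπid _ hu₁, ← h1, hSr _ hu]
      exact funLeft_mk_antiVec_sigmaType Φ i₀ 1
  · -- `W = U(Φ_{i₀})`: additive
    left
    have hWU : W = antiSpan G (Φ i₀) := hirr W inf_le_left hW0 hWst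
    have h0 : (antiSpan G (Φ i₀)).map (slotExt i₀) ≤ M := by
      rintro _ ⟨w, hw, rfl⟩
      rw [← hWU] at hw
      exact hw.2
    have h1 : (antiSpan G (Φ i₁)).map (slotExt i₁) ≤ M := by
      rw [antiSpan, Submodule.map_span_le]
      rintro _ ⟨h, rfl⟩
      have hsum : antiVec (sigmaType Φ) h = slotExt i₀ (antiVec (Φ i₀) h) + slotExt i₁ (antiVec (Φ i₁) h) := by
        rw [antiVec_sigmaType_eq_sigmaLift, sigmaLift_eq_sum_slotExt]
        exact Fintype.sum_eq_add i₀ i₁ h01 fun j hj => by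
          rcases hI j with rfl | rfl
          · exact absurd rfl hj.1
          · exact absurd rfl hj.2
      have heq : slotExt i₁ (antiVec (Φ i₁) h) = antiVec (sigmaType Φ) h - slotExt i₀ (antiVec (Φ i₀) h) := by
        rw [hsum, add_sub_cancel_left]
      rw [heq]
      exact Submodule.sub_mem _ (Submodule.subset_span ⟨h, rfl⟩) (h0 ⟨antiVec (Φ i₀) h, Submodule.subset_span ⟨h, rfl⟩, rfl⟩)
    intro i
    rcases hI i with rfl | rfl
    · exact h0
    · exact h1

/-- **Rank form of the dichotomy**: `U(Φ_{i₀})` irreducible ⟹ `rank(Σ) + 2 = rank Φ_{i₀} + rank Φ_{i₁} + 1` (additive)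
OR `rank(Σ) = rank(Φ_{i₁})` (collapse). [cite: Gordon1999HodgeAVSurvey, §3 Theorem (1) and 7.5–7.7] -/
theorem typeRank_add_card_eq_or_typeRank_eq_of_irreducible [∀ i, Fintype (E i)] [∀ i, Nonempty (E i)]
    (h : ∀ i, IsCMTypeWith ρ (Φ i)) (hI : ∀ j, j = i₀ ∨ j = i₁) (h01 : i₀ ≠ i₁)
    (hirr : ∀ W : Submodule ℚ (E i₀ → ℚ), W ≤ antiSpan G (Φ i₀) → W ≠ ⊥ →
      (∀ (k : G) (f : E i₀ → ℚ), f ∈ W → (fun y => f (k • y)) ∈ W) → W = antiSpan G (Φ i₀)) :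
    typeRank G (sigmaType Φ) + Fintype.card I = (∑ i, typeRank G (Φ i)) + 1 ∨
      typeRank G (sigmaType Φ) = typeRank G (Φ i₁) := by
  haveI : Nonempty I := ⟨i₀⟩
  rcases additive_or_exists_collapse_of_irreducible hI h01 hirr with hadd | ⟨L, hL, -, hLu⟩
  · exact Or.inl (typeRank_sigmaType_add_card_eq_of_forall_map_le h hadd)
  · exact Or.inr (ReflexSlot.typeRank_sigmaType_eq_of_equivariant h hI L hL one_ne_zero (by rw [hLu, one_smul]))

/-! ### §2 The typed transport through a compatible pair-flip slot -/

section Typed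

variable {X Y : Type*} [MulAction G X] [MulAction G Y] [Fintype X] [Fintype Y] [DecidableEq X] [DecidableEq Y]

omit [DecidableEq I] [Fintype I] in
/-- **One constant.**  In the conclusion of `exists_equivariant_equiv`, on a TRANSITIVE `X` the constants agree:
`T f = c · f ∘ γ⁻¹` for every odd weight `f`, with one `c > 0`. [cite: Shimura1998, §32.10 (proof)] [cite: Serre1977, §2.2] -/
theorem apply_eq_smul_comp_symm [MulAction.IsPretransitive G X] [Nonempty X] (hρ : ∀ x : X, ρ • ρ • x = x)
    (hcomm : ∀ (g : G) (x : X), g • ρ • x = ρ • g • x) (hcommY : ∀ (g : G) (y : Y), g • ρ • y = ρ • g • y)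
    (hfreeY : ∀ y : Y, ρ • y ≠ y) (T : (X → ℚ) →ₗ[ℚ] (Y → ℚ))
    (hTeq : ∀ (g : G) (f : X → ℚ), f ∈ antiWeights (E := X) ρ → T (fun x => f (g • x)) = fun y => T f (g • y))
    (γ : X ≃ Y) (hγ : ∀ (g : G) (x : X), γ (g • x) = g • γ x)
    (hc : ∀ x : X, ∃ c : ℚ, 0 < c ∧ T (Pi.single x (1 : ℚ) - Pi.single (ρ • x) 1) =
      c • (Pi.single (γ x) (1 : ℚ) - Pi.single (ρ • γ x) 1 : Y → ℚ)) :
    ∃ c : ℚ, 0 < c ∧ ∀ f : X → ℚ, f ∈ antiWeights (E := X) ρ → T f = c • (f ∘ γ.symm) := by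
  choose c hcpos hcT using hc
  obtain ⟨x₀⟩ : Nonempty X := ⟨Classical.arbitrary X⟩
  -- the constants agree along the orbit of `x₀`, i.e. everywhere
  have hconst : ∀ x, c x = c x₀ := by
    intro x
    obtain ⟨g, rfl⟩ := MulAction.exists_smul_eq G x₀ x
    have h1 := hTeq g _ (single_sub_single_mem_antiWeights hρ (g • x₀))
    rw [single_sub_single_comp_smul hcomm (g • x₀) g, inv_smul_smul, hcT (g • x₀), hcT x₀] at h1
    have h2 : (fun y => (c (g • x₀) • (Pi.single (γ (g • x₀)) (1 : ℚ) - Pi.single (ρ • γ (g • x₀)) 1 : Y → ℚ))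
        (g • y)) = c (g • x₀) • (Pi.single (g⁻¹ • γ (g • x₀)) (1 : ℚ) - Pi.single (ρ • g⁻¹ • γ (g • x₀)) 1 : Y → ℚ) := by
      rw [← single_sub_single_comp_smul hcommY (γ (g • x₀)) g]
      rfl
    rw [h2, hγ g x₀, inv_smul_smul] at h1
    exact ((eq_of_pos_smul_eq hfreeY (hcpos x₀) (hcpos (g • x₀)) h1).2).symm
  have hγρ : ∀ y : Y, γ.symm (ρ • y) = ρ • γ.symm y := fun y =>
    γ.injective (by rw [Equiv.apply_symm_apply, hγ, Equiv.apply_symm_apply])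
  refine ⟨c x₀, hcpos x₀, fun f hf => ?_⟩
  -- expand `f` and `f ∘ γ⁻¹` in the elementary odd vectors
  have hfodd : (f ∘ γ.symm) ∈ antiWeights (E := Y) ρ := by
    rw [mem_antiWeights_iff']
    intro y
    change f (γ.symm (ρ • y)) = -f (γ.symm y)
    rw [hγρ, (mem_antiWeights_iff'.1 hf)]
  have hρY : ∀ y : Y, ρ • ρ • y = y := fun y => γ.symm.injective (by rw [hγρ, hγρ, hρ])
  have hTf : T f = (1 / 2 : ℚ) • ∑ x, f x • T (Pi.single x (1 : ℚ) - Pi.single (ρ • x) 1) := by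
    conv_lhs => rw [eq_sum_smul_single_sub_of_mem_antiWeights hρ hf]
    rw [map_smul, map_sum]
    congr 1
    exact Finset.sum_congr rfl fun x _ => by rw [map_smul]
  have hfg : (f ∘ γ.symm) = (1 / 2 : ℚ) • ∑ x, f x • (Pi.single (γ x) (1 : ℚ) - Pi.single (ρ • γ x) 1 : Y → ℚ) := by
    conv_lhs => rw [eq_sum_smul_single_sub_of_mem_antiWeights hρY hfodd]
    congr 1
    rw [← Equiv.sum_comp γ]
    refine Finset.sum_congr rfl fun x _ => ?_
    rw [Function.comp_apply, Equiv.symm_apply_apply]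
  rw [hTf, hfg, smul_comm (c x₀) (1 / 2 : ℚ)]
  congr 1
  rw [Finset.smul_sum]
  refine Finset.sum_congr rfl fun x _ => ?_
  rw [hcT x, hconst x, smul_comm (f x) (c x₀)]

/-- **The typed transport.**  `X = E_{i₀}` transitive with pair flips compatible with `Y = E_{i₁}`, `|X| = |Y|`, CM types
`Φ_{i₀}`, `Φ_{i₁}` for `ρ`.  If the pair `{i₀, i₁}` is NOT additive (`Hg(A₀ × A₁) ≠ Hg(A₀) × Hg(A₁)`), there is a
`G`-equivariant bijection `γ : X ≃ Y` carrying `Φ_{i₀}` onto `Φ_{i₁}`.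
[cite: Gordon1999HodgeAVSurvey, §3 Theorem and 7.5–7.7] [cite: Dodson1984, §5.1.2] [cite: Shimura1998, §32.10] -/
theorem exists_equivariant_equiv_mem_iff_of_not_additive {E : I → Type*} [∀ i, MulAction G (E i)]
    [∀ i, Fintype (E i)] [∀ i, DecidableEq (E i)] {Φ : ∀ i, Set (E i)} [MulAction.IsPretransitive G (E i₀)]
    [Nonempty (E i₀)] (h : ∀ i, IsCMTypeWith ρ (Φ i)) (hI : ∀ j, j = i₀ ∨ j = i₁) (h01 : i₀ ≠ i₁)
    (hflip : ∀ x : E i₀, ∃ φ : G, φ • x = ρ • x ∧ (∀ x' : E i₀, x' ≠ x → x' ≠ ρ • x → φ • x' = x') ∧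
      ∀ y : E i₁, φ • y = y ∨ φ • y = ρ • y)
    (hcard : Fintype.card (E i₀) = Fintype.card (E i₁))
    (hna : ¬ ∀ i, (antiSpan G (Φ i)).map (slotExt i) ≤ antiSpan G (sigmaType Φ)) :
    ∃ γ : E i₀ ≃ E i₁, (∀ (g : G) (x : E i₀), γ (g • x) = g • γ x) ∧ ∀ x : E i₀, x ∈ Φ i₀ ↔ γ x ∈ Φ i₁ := by
  classical
  have hflip' : ∀ x : E i₀, ∃ φ : G, φ • x = ρ • x ∧ ∀ x' : E i₀, x' ≠ x → x' ≠ ρ • x → φ • x' = x' :=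
    fun x => (hflip x).imp fun φ hφ => ⟨hφ.1, hφ.2.1⟩
  have hUA : antiSpan G (Φ i₀) = antiWeights (E := E i₀) ρ := antiSpan_eq_antiWeights_of_pairFlip (h i₀) hflip'
  have hirr := antiSpan_irreducible_of_pairFlip (h i₀) hflip'
  obtain ⟨L, hL, hLmem, hLu⟩ := (additive_or_exists_collapse_of_irreducible hI h01 hirr).resolve_left hna
  -- `L(U(Φ_{i₁}))` is a non-zero stable subspace of the irreducible `U(Φ_{i₀})`, hence everything
  set P := antiSpan G (Φ i₁) with hP
  have hPst : ∀ (k : G) (f : E i₁ → ℚ), f ∈ P → (fun y => f (k • y)) ∈ P := fun k f hf => comp_smul_mem_antiSpan hf k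
  have hu₁ : antiVec (Φ i₁) (1 : G) ∈ P := Submodule.subset_span ⟨1, rfl⟩
  have hu₀ : antiVec (Φ i₀) (1 : G) ≠ 0 := fun h0 => by
    have := congrFun h0 (Classical.arbitrary (E i₀))
    simp only [antiVec, Pi.zero_apply] at this
    by_cases hm : (1 : G) • Classical.arbitrary (E i₀) ∈ Φ i₀
    · rw [translateInd_of_mem hm] at this; norm_num at this
    · rw [translateInd_of_not_mem hm] at this; norm_num at this
  have hQ : P.map L = antiSpan G (Φ i₀) := by
    refine hirr _ (fun f hf => ?_) ?_ fun k f hf => ?_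
    · obtain ⟨p, hp, rfl⟩ := Submodule.mem_map.1 hf; exact hLmem p hp
    · rw [Submodule.ne_bot_iff]
      exact ⟨_, Submodule.mem_map_of_mem hu₁, by rw [hLu]; exact hu₀⟩
    · obtain ⟨p, hp, rfl⟩ := Submodule.mem_map.1 hf
      exact Submodule.mem_map.2 ⟨fun y => p (k • y), hPst k p hp, hL k p⟩
  -- dimension count: `dim U(Φ_{i₁}) ≤ |Y|/2 = |X|/2 = dim Anti(X) = dim L(U(Φ_{i₁}))`, so `L` is injective on `U(Φ_{i₁})`
  have hdimX : Module.finrank ℚ (antiWeights (E := E i₀) ρ) = Fintype.card (E i₀) / 2 :=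
    finrank_antiWeights_eq_of_typeRank_eq (h i₀) (typeRank_eq_of_pairFlip (h i₀) hflip')
  have hdimP : Module.finrank ℚ P ≤ Fintype.card (E i₁) / 2 := by
    haveI : Nonempty (E i₁) := by
      rw [← Fintype.card_pos_iff, ← hcard]; exact Fintype.card_pos
    have h1 := (h i₁).typeRank_eq_finrank_antiSpan_add_one
    have h2 := (h i₁).typeRank_le
    rw [← hP] at h1
    omega
  have hLinj : ∀ f, f ∈ P → L f = 0 → f = 0 := by
    -- the restriction `P → ℚ^X` of `L` has range of dimension `dim P`, so its kernel is trivial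
    have hr : Module.finrank ℚ (LinearMap.range (L ∘ₗ P.subtype)) = Module.finrank ℚ P := by
      apply le_antisymm (LinearMap.finrank_range_le _)
      rw [LinearMap.range_comp, Submodule.range_subtype, hQ, hUA, hdimX, hcard]
      exact hdimP
    have hker : LinearMap.ker (L ∘ₗ P.subtype) = ⊥ := by
      have := LinearMap.finrank_range_add_finrank_ker (L ∘ₗ P.subtype)
      rw [hr] at this
      exact Submodule.finrank_eq_zero.1 (by omega)
    intro f hf hf0
    have : (⟨f, hf⟩ : P) ∈ LinearMap.ker (L ∘ₗ P.subtype) := by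
      rw [LinearMap.mem_ker]; exact hf0
    rw [hker, Submodule.mem_bot] at this
    exact congrArg Subtype.val this
  -- invert `L` on its image `Anti(X)` (F1b) and transport (F1)
  obtain ⟨S, hSP, hSL, -, hSeq, hSinj⟩ := exists_inverse_on_map (G := G) P (fun k f hf => hPst k f hf) L
    (fun k f _ => hL k f) hLinj
  rw [hQ, hUA] at hSeq hSinj
  have hAY : P ≤ antiWeights (E := E i₁) ρ := antiSpan_le_antiWeights' (h i₁)
  obtain ⟨γ, hγ, hc⟩ := exists_equivariant_equiv (h i₀).invol (h i₀).comm (h i₀).rho_smul_ne (h i₁).invol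
    (h i₁).comm (h i₁).rho_smul_ne hflip S hSeq (fun f _ => hAY (hSP f)) hSinj hcard
  obtain ⟨c, hcpos, hcS⟩ := apply_eq_smul_comp_symm (h i₀).invol (h i₀).comm (h i₁).comm (h i₁).rho_smul_ne S hSeq
    γ hγ hc
  -- `S u₀ = u₁`, so `u₁ = c · u₀ ∘ γ⁻¹` with `±1` values: `c = 1`
  have hSu : S (antiVec (Φ i₀) (1 : G)) = antiVec (Φ i₁) (1 : G) := by rw [← hLu, hSL _ hu₁]
  have hkey : ∀ x : E i₀, antiVec (Φ i₁) (1 : G) (γ x) = c * antiVec (Φ i₀) (1 : G) x := by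
    intro x
    have h1 := congrFun ((hSu.symm.trans (hcS _ (antiVec_mem_antiWeights (h i₀) 1)))) (γ x)
    rw [Pi.smul_apply, Function.comp_apply, Equiv.symm_apply_apply, smul_eq_mul] at h1
    exact h1
  refine ⟨γ, hγ, fun x => ?_⟩
  have h1 := hkey x
  simp only [antiVec] at h1
  by_cases hx : x ∈ Φ i₀ <;> by_cases hy : γ x ∈ Φ i₁
  · exact ⟨fun _ => hy, fun _ => hx⟩
  · rw [translateInd_of_mem (show (1 : G) • x ∈ Φ i₀ by rwa [one_smul]),
      translateInd_of_not_mem (show (1 : G) • γ x ∉ Φ i₁ by rwa [one_smul])] at h1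
    norm_num at h1; linarith
  · rw [translateInd_of_not_mem (show (1 : G) • x ∉ Φ i₀ by rwa [one_smul]),
      translateInd_of_mem (show (1 : G) • γ x ∈ Φ i₁ by rwa [one_smul])] at h1
    norm_num at h1; linarith
  · exact ⟨fun h' => absurd h' hx, fun h' => absurd h' hy⟩

end Typed

end PairFlipTransport

end Literature.NumberTheory.ComplexMultiplication
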